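import Literature.NumberTheory.EllipticCurves.CongruenceVisibility
import HarnessLib

/-!
# At an archimedean place the FINITE-LEVEL Selmer local condition holds after multiplication by `2`

`Proofs`-style file (theorems only: no definition, no named fact, no `sorry`) in topic
`NumberTheory/EllipticCurves`, the finite-level (`E[n]`-coefficient) twin of
`ArchimedeanLocalCondition.lean` (`two_nsmul_mem_localRestrictionKer_infinitePlace` for `H¹(K, E)`
and `two_nsmul_mem_selmerLocalKerPrimary_infinitePlace` for `E[p^∞]`).  For a Weierstrass curve `W`
over a number field `K` (in `Type`, as there: the auxiliary tower uses Mathlib's `ℂ : Type`), an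
integer `n`, an infinite place `w` and a class `c ∈ H¹(K, E[n])`:
`2 • c ∈ selmerLocalKer W K_w n`.  The local condition at level `n` is the preimage of the
`H¹(·, E)` condition under `H¹(K, E[n]) → H¹(K, E)` (`mem_selmerLocalKer_iff_torsionH1ToH1_mem`,
both directions on cocycles; the tree had the forward inclusion
`torsionH1ToH1_mem_localRestrictionKer`).

Written as the «free archimedean helper» of the discharge of
`Kato2004.locP_kernel_isTorsion_of_rankOne` (cell `bsd-cn100`, plan g15 RULING-3 (d); assembly by
seat `bsd-cn100-s2-c3`, this file by `bsd-cn100-transfer-2` g6).  Nothing about BSD is claimed.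

## References

* [SerreGaloisCohomology1997] J.-P. Serre, *Galois Cohomology* (1997), I.§2.4 (Cor. to Prop. 9:
  `H¹(ℝ, ·)` is killed by `2`).
* [GrossLMS1991] B. H. Gross, *Kolyvagin's work on modular elliptic curves*, LMS LNS 153 (1991),
  §6, proof of Prop. 6.2 (1) (the archimedean places).
-/

noncomputable section

open scoped Classical

namespace WeierstrassCurve

open Literature.NumberTheory.EllipticCurves Literature.NumberTheory.GaloisRepresentations Field
open NumberField

section Comap

universe u

variable {K : Type u} [Field K] (W : WeierstrassCurve K) {n : ℤ} (E : Type u) [Field E]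
  [Algebra K E]

/-- **The level-`n` local condition is the preimage of the `H¹(·, E)` condition**:
`c ∈ selmerLocalKer W E n ↔ torsionH1ToH1 W n c ∈ localRestrictionKer W E` — both say that the
cocycle `σ ↦ φ(res σ)` of `c`, read in `E(K̄_E)`, is a coboundary there (the tree's
`torsionH1ToH1_mem_localRestrictionKer` is the forward direction). [cite: SerreGaloisCohomology1997, I.§2.4] -/
theorem mem_selmerLocalKer_iff_torsionH1ToH1_mem (c : galH1Torsion W n) :
    c ∈ selmerLocalKer W E n ↔ torsionH1ToH1 W n c ∈ W.localRestrictionKer E := by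
  refine ⟨torsionH1ToH1_mem_localRestrictionKer W E, fun hc ↦ ?_⟩
  obtain ⟨φ, rfl⟩ :=
    oneCocycleClass_surjective (discreteTopRep (absoluteGaloisGroup K) (geomTorsion W n)) c
  unfold torsionH1ToH1 at hc
  simp only [LinearMap.toAddMonoidHom_coe, ContinuousLinearMap.coe_coe] at hc
  rw [map_oneCocycleClass, localRestrictionKer, oneCocycleClass_mem_resKer_iff] at hc
  obtain ⟨a, ha⟩ := hc
  rw [selmerLocalKer, oneCocycleClass_mem_resKer_iff]
  exact ⟨a, fun σ ↦ ha σ⟩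

end Comap

section Archimedean

variable {K : Type} [Field K] [NumberField K] (W : WeierstrassCurve K)

/-- **At an infinite place the level-`n` Selmer local condition holds up to `2`**: for every integer
`n`, every infinite place `w` of `K` and every `c ∈ H¹(K, E[n])`, `2 • c ∈ selmerLocalKer W K_w n`
(complex `w`: `K_w ≅ ℂ`, `Γ_{K_w}` trivial; real `w`: `H¹(ℝ, ·)` is killed by `2` — the tree's
`two_nsmul_mem_localRestrictionKer_infinitePlace`, pulled back along
`mem_selmerLocalKer_iff_torsionH1ToH1_mem`). [cite: SerreGaloisCohomology1997, I.§2.4 Cor. to Prop. 9]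
[cite: GrossLMS1991, §6 (proof of Prop. 6.2 (1))] -/
theorem two_nsmul_mem_selmerLocalKer_infinitePlace (n : ℤ) (w : InfinitePlace K)
    (c : galH1Torsion W n) : 2 • c ∈ selmerLocalKer W w.Completion n := by
  rw [mem_selmerLocalKer_iff_torsionH1ToH1_mem, map_nsmul]
  exact two_nsmul_mem_localRestrictionKer_infinitePlace W w _

end Archimedean

end WeierstrassCurve

end
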